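import Summits.AtomisticToContinuum.BoseEinsteinCondensation.Theorems.BECCutLineWeakDisorderGroundStateRigidityStubClosedEnergyTruncHardCoreAux
import Summits.AtomisticToContinuum.BoseEinsteinCondensation.Theorems.BECCutLineWeakDisorderGroundStateRigidityStubKineticCauchy
import Summits.AtomisticToContinuum.BoseEinsteinCondensation.Theorems.BECCutLineWeakDisorderGroundStateRigidityStubTruncDiagonal
import HarnessLib

/-!
# Crux `GroundStateRigidity` (stmt-AtomisticToContinuum-9072), line `Sketch`:
# the registered stub `stub_closedEnergyTruncHardCore` (Stub 15g, the glue of Stub 15)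

Supports (does not close) stmt-AtomisticToContinuum-9072; stub `stub_closedEnergyTruncHardCore`
of line Sketch (lead c4, skeleton v8). **Closed-form energy truncation for the hard-core class**:
for `v = ⊤` on `[0, b]`, `v ≤ C` beyond `b`, and a measurable `Ψ`,
`q̄_v[Ψ] ≤ S := supₙ q̄_{v ⊓ n}[Ψ]`, GIVEN (as hypotheses, not re-proved) the registered statements
of the neighbouring stubs 15a `stub_coreCutoff` (pair cutoffs with gradient `≲ (r₂ - r₁)⁻²` in
the layer), 15b `stub_shellMassOfCutoff` (shell mass `≲ s² ·` layer kinetic energy `+` core mass)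
and 15d `stub_layerKineticVanishing` (the layer kinetic energy of ONE function is small for thin
layers); the landed Stubs 15c `stub_kineticCauchy`, 15e `stub_truncDiagonal`, 15f
`stub_cutStateBound` are used by name.

Proof (`S < ⊤`). Diagonal trial states `Φₘ → Ψ` with `energy (v ⊓ m) Φₘ ≤ S + 1/(m+1)` (15e);
core mass `m ∫_{some pair ≤ b} |Φₘ|² ≤ S + 1` (`v ⊓ m = m` on `[0, b]`); the `Φₘ` are Cauchy in
kinetic energy (15c), so 15d applied to one `Φ_M` bounds the layer kinetic energy of all later
`Φₘ` by `4ε`; 15b (with the cutoff of 15a at radii `b - s < b`) bounds the shell masses; 15f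
with the cutoff `χ` of 15a at radii `b < b + 3s` (`|∇χ|² ≤ A/(9s²)`: the `s²` cancel) gives cut
states `Gₖ = χ Φₘ → Ψ` in `L²` with `Q_v(Gₖ) ≤ (1 + θₖ)(S + τₖ) + τₖ`, `θₖ, τₖ → 0` (all this is
`ClosedEnergyTrunc.one_step` of the auxiliary file
`BECCutLineWeakDisorderGroundStateRigidityStubClosedEnergyTruncHardCoreAux.lean`); normalising
(`LincombGS.exists_trialState_normalize`, masses `→ 1` by
`ExistsNonneg.tendsto_lintegral_nnnorm_sq`) and `closedEnergy_le_liminf` conclude.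
-/

noncomputable section

open MeasureTheory Filter Set Metric
open scoped ENNReal NNReal Topology

namespace Summit.AtomisticToContinuum.BoseEinsteinCondensation.Theorems.GroundStateRigidity

open Literature.MathematicalPhysics.QuantumManyBody.BoseGas
open Literature.Analysis.FunctionSpaces (tendsto_inv_natCast_add_one)

/-! ### The stub -/

open ClosedEnergyTrunc in
/-- **Stub 15g — closed-form energy truncation for the hard-core class (the glue).** GIVEN the
statements of Stubs 15a `stub_coreCutoff`, 15b `stub_shellMassOfCutoff`, 15d
`stub_layerKineticVanishing` as hypotheses (15c, 15e, 15f are landed theorems, used by name):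
for `v = ⊤` on `[0, b]`, `v ≤ C` beyond `b` (measurable), `N ≥ 1`, `L > 0` and a measurable `Ψ`,
`q̄_v[Ψ] ≤ supₙ q̄_{v ⊓ n}[Ψ] =: S`. If `S < ⊤`: diagonal trial states `Φₘ → Ψ` in `L²` with
`energy (v ⊓ m) Φₘ ≤ S + 1/(m+1)` (`stub_truncDiagonal`), Cauchy in kinetic energy
(`stub_kineticCauchy`; `S ≤ q̄_{v ⊓ m₀}[Ψ] + δ` from `lt_iSup_iff`); for `θₖ = τₖ = 1/(k+1)` the
cut states `Gₖ` of `ClosedEnergyTrunc.one_step` converge to `Ψ` in `L²`, have masses `→ 1`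
(`ExistsNonneg.tendsto_lintegral_nnnorm_sq`, `‖Ψ‖₂ = 1` by `TendstoL2.lintegral_nnnorm_sq_eq_one`)
and raw forms `≤ (1+θₖ)(S+τₖ) + τₖ → S`; their normalisations
(`LincombGS.exists_trialState_normalize`) are trial states converging to `Ψ` with energies
`≤ ‖Gₖ‖₂⁻² ((1+θₖ)(S+τₖ) + τₖ) → S`, and `closedEnergy_le_liminf` concludes.
[cite: Kato1966, VI §1.3 Thm 1.16] -/
theorem stub_closedEnergyTruncHardCore :
    (∀ (N : ℕ), ∃ A : ℝ≥0, ∀ r₁ r₂ : ℝ, 0 < r₁ → r₁ < r₂ →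
      ∃ χ : Config N → ℝ, ContDiff ℝ 1 χ ∧ (∀ X, 0 ≤ χ X ∧ χ X ≤ 1) ∧
        (∀ (σ : Equiv.Perm (Fin N)) (X : Config N), χ (X ∘ σ) = χ X) ∧
        (∀ X : Config N, (∃ i j : Fin N, i ≠ j ∧ dist (X i) (X j) ≤ r₁) → χ X = 0) ∧
        (∀ X : Config N, (∀ i j : Fin N, i ≠ j → r₂ ≤ dist (X i) (X j)) → χ X = 1) ∧
        (∀ X : Config N, realKinetic χ X ≤
          {Y : Config N | ∃ i j : Fin N, i ≠ j ∧ r₁ < dist (Y i) (Y j) ∧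
              dist (Y i) (Y j) < r₂}.indicator
            (fun _ => ENNReal.ofReal ((A : ℝ) / (r₂ - r₁) ^ 2)) X)) →
    (∀ (N : ℕ) (b s : ℝ) (A : ℝ≥0) (η : Config N → ℝ) (ψ : Config N → ℂ) (i j : Fin N), i ≠ j →
      0 < s → 81 * s ≤ b → ContDiff ℝ 1 η → (∀ X, 0 ≤ η X ∧ η X ≤ 1) →
      (∀ X : Config N, (∃ i' j' : Fin N, i' ≠ j' ∧ dist (X i') (X j') ≤ b - s) → η X = 0) →
      (∀ X : Config N, (∀ i' j' : Fin N, i' ≠ j' → b ≤ dist (X i') (X j')) → η X = 1) →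
      (∀ X : Config N, realKinetic η X ≤
        {Y : Config N | ∃ i' j' : Fin N, i' ≠ j' ∧ b - s < dist (Y i') (Y j') ∧
            dist (Y i') (Y j') < b}.indicator (fun _ => ENNReal.ofReal ((A : ℝ) / s ^ 2)) X) →
      ContDiff ℝ 1 ψ →
      ∫⁻ X, (shellPair b (3 * s) i j).indicator (fun Y => (‖ψ Y‖₊ : ℝ≥0∞) ^ 2) X ≤
        ENNReal.ofReal (288 * s ^ 2) *
            (∫⁻ X, (shellPair (b - s) (4 * s) i j).indicator (kineticDensity ψ) X) +
          (288 * (A : ℝ≥0∞) + 1) *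
            ∫⁻ X, {Y : Config N | ∃ i' j' : Fin N, i' ≠ j' ∧ dist (Y i') (Y j') < b}.indicator
              (fun Y => (‖ψ Y‖₊ : ℝ≥0∞) ^ 2) X) →
    (∀ (N : ℕ) (b : ℝ) (Φ : Config N → ℂ), ContDiff ℝ 1 Φ → ∫⁻ X, kineticDensity Φ X ≠ ⊤ →
      ∀ ε : ℝ≥0∞, 0 < ε → ∃ s : ℝ, 0 < s ∧
        ∫⁻ X, {Y : Config N | ∃ i j : Fin N, i ≠ j ∧ b - s < dist (Y i) (Y j) ∧
            dist (Y i) (Y j) < b + 3 * s}.indicator (kineticDensity Φ) X ≤ ε) →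
    ∀ (N : ℕ) (v : ℝ → ℝ≥0∞) (L b : ℝ) (C : ℝ≥0), 1 ≤ N → 0 < L → 0 < b → Measurable v →
      (∀ s : ℝ, s ∈ Set.Icc 0 b → v s = ⊤) → (∀ s : ℝ, b < s → v s ≤ C) →
      ∀ Ψ : Config N → ℂ, Measurable Ψ →
        closedEnergy v L Ψ ≤ ⨆ n : ℕ, closedEnergy (fun r => min (v r) (n : ℝ≥0∞)) L Ψ := by
  intro hCut hShell hLayer N v L b C _hN _hL hb hv hcore hC Ψ hΨ
  set S : ℝ≥0∞ := ⨆ n : ℕ, closedEnergy (fun r => min (v r) (n : ℝ≥0∞)) L Ψ with hS_def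
  rcases eq_or_ne S ⊤ with hST | hST
  · rw [hST]; exact le_top
  obtain ⟨A, hA⟩ := hCut N
  -- diagonal near-optimal trial states (Stub 15e) and their `L²` limit
  obtain ⟨Φ, hΦE, hΦd⟩ := stub_truncDiagonal N L (fun (m : ℕ) r => min (v r) (m : ℝ≥0∞)) Ψ S
    (fun m => le_iSup (fun n : ℕ => closedEnergy (fun r => min (v r) (n : ℝ≥0∞)) L Ψ) m) hST
  have hΦΨ : TendstoL2 Φ Ψ := tendsto_of_tendsto_of_tendsto_of_le_of_le tendsto_const_nhds
    tendsto_inv_natCast_add_one (fun _ => zero_le) hΦd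
  have hΨ1 : ∫⁻ X, (‖Ψ X‖₊ : ℝ≥0∞) ^ 2 = 1 :=
    hΦΨ.lintegral_nnnorm_sq_eq_one hΨ.aestronglyMeasurable
  -- the kinetic Cauchy property (Stub 15c)
  have hE : ∀ δ : ℝ≥0∞, 0 < δ → ∀ᶠ m : ℕ in atTop,
      energy (fun r => min (v r) (m : ℝ≥0∞)) (Φ m) ≤ S + δ := fun δ hδ =>
    (tendsto_inv_natCast_add_one.eventually_le_const hδ).mono fun m hm =>
      (hΦE m).trans (add_le_add le_rfl hm)
  have hCδ : ∀ δ : ℝ≥0∞, 0 < δ → ∃ m₀ : ℕ,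
      S ≤ closedEnergy (fun r => min (v r) (m₀ : ℝ≥0∞)) L Ψ + δ := by
    intro δ hδ
    rcases eq_or_ne S 0 with h0 | h0
    · exact ⟨0, by rw [h0]; exact zero_le⟩
    · have hlt : S - δ < ⨆ n : ℕ, closedEnergy (fun r => min (v r) (n : ℝ≥0∞)) L Ψ := by
        rw [← hS_def]; exact ENNReal.sub_lt_self hST h0 hδ.ne'
      obtain ⟨m₀, hm₀⟩ := lt_iSup_iff.1 hlt
      exact ⟨m₀, tsub_le_iff_right.1 hm₀.le⟩
  have hCauchy := stub_kineticCauchy N L (fun (m : ℕ) r => min (v r) (m : ℝ≥0∞)) Φ Ψ S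
    (fun m => hv.min measurable_const) (fun m m' hmm' r => min_le_min_left (v r)
      (by exact_mod_cast hmm')) hST hΨ hΦΨ hE hCδ
  -- the cut states `Gₖ` (`θₖ = τₖ = 1/(k+1)`)
  have hτk : ∀ k : ℕ, (0 : ℝ≥0∞) < ((k : ℝ≥0∞) + 1)⁻¹ := fun k =>
    ENNReal.inv_pos.2 (by finiteness)
  have step : ∀ k : ℕ, ∃ G : Config N → ℂ, ContDiff ℝ 1 G ∧ (∀ X, X ∉ boxN N L → G X = 0) ∧
      (∀ (σ : Equiv.Perm (Fin N)) (X : Config N), G (X ∘ σ) = G X) ∧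
      ∫⁻ X, (‖G X - Ψ X‖₊ : ℝ≥0∞) ^ 2 ≤ 4 * ((k : ℝ≥0∞) + 1)⁻¹ ∧
      ∫⁻ X, kineticDensity G X + interaction v X * (‖G X‖₊ : ℝ≥0∞) ^ 2 ≤
        ENNReal.ofReal (1 + 1 / ((k : ℝ) + 1)) * (S + ((k : ℝ≥0∞) + 1)⁻¹) +
          ((k : ℝ≥0∞) + 1)⁻¹ := fun k =>
    one_step hA (fun s η ψ i j => hShell N b s A η ψ i j) (hLayer N b) hb hv hcore hC hST hΦE
      hΦd hCauchy Nat.one_div_pos_of_nat (hτk k)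
  choose G hGc hG0 hGσ hGd hGQ using step
  -- `Gₖ → Ψ` in `L²`, so the masses tend to `1`
  have hGF : Tendsto (fun k => ∫⁻ X, (‖G k X - Ψ X‖₊ : ℝ≥0∞) ^ 2) atTop (𝓝 0) := by
    have h := ENNReal.Tendsto.const_mul tendsto_inv_natCast_add_one (Or.inr ENNReal.ofNat_ne_top)
      (a := (4 : ℝ≥0∞))
    rw [mul_zero] at h
    exact tendsto_of_tendsto_of_tendsto_of_le_of_le tendsto_const_nhds h (fun _ => zero_le) hGd
  have hm : Tendsto (fun k => ∫⁻ X, (‖G k X‖₊ : ℝ≥0∞) ^ 2) atTop (𝓝 1) :=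
    ExistsNonneg.tendsto_lintegral_nnnorm_sq (fun k => (hGc k).continuous.aestronglyMeasurable)
      hΨ.aestronglyMeasurable hΨ1 hGF
  -- the raw-form bounds tend to `S`
  have hB : Tendsto (fun k : ℕ => ENNReal.ofReal (1 + 1 / ((k : ℝ) + 1)) *
      (S + ((k : ℝ≥0∞) + 1)⁻¹) + ((k : ℝ≥0∞) + 1)⁻¹) atTop (𝓝 S) := by
    have h1 : Tendsto (fun k : ℕ => ENNReal.ofReal (1 + 1 / ((k : ℝ) + 1))) atTop (𝓝 1) := by
      have h := ENNReal.tendsto_ofReal (tendsto_one_div_add_atTop_nhds_zero_nat.const_add (1 : ℝ))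
      rwa [add_zero, ENNReal.ofReal_one] at h
    have h2 : Tendsto (fun k : ℕ => S + ((k : ℝ≥0∞) + 1)⁻¹) atTop (𝓝 S) := by
      have h := tendsto_inv_natCast_add_one.const_add S
      rwa [add_zero] at h
    have h3 := ENNReal.Tendsto.mul h1 (Or.inl one_ne_zero) h2 (Or.inr ENNReal.one_ne_top)
    rw [one_mul] at h3
    have h4 := h3.add tendsto_inv_natCast_add_one
    rwa [add_zero] at h4
  -- the normalised cut states (junk where the mass vanishes, finitely often)
  choose Θ hΘ _hlow using fun k =>
    LincombGS.exists_trialState_normalize (Φ 0) v (hGc k) (hG0 k) (hGσ k)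
  have hev : ∀ᶠ k in atTop, ∫⁻ X, (‖G k X‖₊ : ℝ≥0∞) ^ 2 ≠ 0 := hm.eventually_ne one_ne_zero
  have hΘΨ : TendstoL2 Θ Ψ := by
    have hcst : Tendsto (fun k => Real.sqrt ((∫⁻ X, (‖G k X‖₊ : ℝ≥0∞) ^ 2).toReal)⁻¹) atTop
        (𝓝 1) := by
      have h1' := (ENNReal.tendsto_toReal ENNReal.one_ne_top).comp hm
      rw [ENNReal.toReal_one] at h1'
      have h2' := (Real.continuous_sqrt.tendsto _).comp (h1'.inv₀ one_ne_zero)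
      rwa [inv_one, Real.sqrt_one] at h2'
    refine (ExistsNonneg.tendsto_lintegral_const_mul_sub (G := G) hΨ hΨ1 hcst hGF).congr'
      (hev.mono fun k hk => ?_)
    beta_reduce
    rw [(hΘ k hk).1]
  have hEΘ : ∀ᶠ k in atTop, energy v (Θ k) ≤ (∫⁻ X, (‖G k X‖₊ : ℝ≥0∞) ^ 2)⁻¹ *
      (ENNReal.ofReal (1 + 1 / ((k : ℝ) + 1)) * (S + ((k : ℝ≥0∞) + 1)⁻¹) +
        ((k : ℝ≥0∞) + 1)⁻¹) :=
    hev.mono fun k hk => by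
      rw [(hΘ k hk).2]
      exact mul_le_mul' le_rfl (hGQ k)
  have hlim : Tendsto (fun k : ℕ => (∫⁻ X, (‖G k X‖₊ : ℝ≥0∞) ^ 2)⁻¹ *
      (ENNReal.ofReal (1 + 1 / ((k : ℝ) + 1)) * (S + ((k : ℝ≥0∞) + 1)⁻¹) +
        ((k : ℝ≥0∞) + 1)⁻¹)) atTop (𝓝 S) := by
    have h := hm.inv
    rw [inv_one] at h
    have h' := ENNReal.Tendsto.mul h (Or.inl one_ne_zero) hB (Or.inr ENNReal.one_ne_top)
    rwa [one_mul] at h'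
  exact (closedEnergy_le_liminf v hΘΨ).trans ((liminf_le_liminf hEΘ).trans hlim.liminf_eq.le)

end Summit.AtomisticToContinuum.BoseEinsteinCondensation.Theorems.GroundStateRigidity

end
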